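import Literature.Analysis.FunctionSpaces.BMO
import Literature.Analysis.FunctionSpaces.BMOCarlesonFeffermanStein

/-!
# `BMO⁻¹ ⊂ Ḃ^{-1}_{∞,∞}`: proof of `Literature.Analysis.FunctionSpaces.MemBMOInv.memHomBesov_neg_one_top`

Topic `Literature/Analysis/FunctionSpaces` (a proofs companion of `BMO.lean`, next to
`BMOProofs.lean`). This file **proves** the named fact `Literature.Analysis.FunctionSpaces.MemBMOInv.memHomBesov_neg_one_top` of
`BMO.lean` (Koch–Tataru, Adv. Math. 157 (2001), §1 and (22): the caloric extension of
`u ∈ BMO⁻¹` satisfies `|e^{tΔ}u| ≤ c t^{-1/2} ‖u‖_{BMO⁻¹}`, i.e. `BMO⁻¹ ⊂ Ḃ^{-1}_{∞,∞}`;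
Lemarié-Rieusset 2016, p. 229): `Literature.Analysis.FunctionSpaces.MemBMOInv.memHomBesov_neg_one_top_holds`.
Two classical ingredients are proved on the way:

* `Literature.Analysis.FunctionSpaces.bmo_weighted_oscillation_le` — Grafakos, *Modern Fourier Analysis* (3rd ed.),
  Prop. 3.1.5 (ii) with `δ = 1`: `R ∫ |f - Avg_{B(x₀,R)} f| (R + |x - x₀|)^{-d-1} dx ≤ C_d ‖f‖_BMO`,
  from the dyadic-shell tail estimate `Literature.Analysis.FunctionSpaces.MemBMO.lintegral_compl_ball_enorm_sub_average_mul_le`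
  of `BMOCarlesonFeffermanStein.lean`;
* `Literature.Analysis.FunctionSpaces.HasWeakDivergenceRepresentation.integral_schwartz_mul_eq` — the weak divergence identity
  `∫ u ψ = -∫ dψ(Φ)` for Schwartz (instead of compactly supported) test functions, when `Φ` is
  polynomially integrable and `ψ u ∈ L¹`, by the cutoff argument (`integral_mul_eq_of_decay`:
  test with `χₙ ψ`, `χₙ = β(·/(n+1))`, and pass to the limit by dominated convergence), applied
  to `re ψ` and `im ψ`.

## Proof (Littlewood–Paley route)

Write `u = div Φ` with `Φᵢ = ⟪Φ, bᵢ⟫ ∈ BMO` (`b` the standard orthonormal basis). For a smooth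
compactly supported profile `ρ` (`ρ = φ₀` for the blocks `Δ̇ⱼ = φ₀(2^{-j}D)`, `ρ = χ` for the
cutoffs `Ṡⱼ = χ(2^{-j}D)`) and `ψ = 𝓕(ρ(2^{-j}·) 𝓕⁻¹φ)` one has
`⟨ρ(2^{-j}D) U, φ⟩ = ∫ ψ u = -∫ dψ(Φ) = -∑ᵢ ∫ Φᵢ ∂ᵢψ` and `∂ᵢψ = 2ʲ 𝓕(τᵢ(2^{-j}·) 𝓕⁻¹φ)`
with `τᵢ(η) = -2πi ⟪η, bᵢ⟫ ρ(η)`, a smooth compactly supported symbol *vanishing at the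
origin*; its kernel `Kᵢⱼ = 𝓕τᵢ(2^{-j}·) = 2^{jd} Kᵢ(2ʲ·)` is a Schwartz function of mean zero,
so that (Fubini)
`⟨ρ(2^{-j}D) U, φ⟩ = ∫ φ Gⱼ` with `Gⱼ(y) = -2ʲ ∑ᵢ ∫ Kᵢⱼ(x - y) Φᵢ(x) dx` and, subtracting the
average of `Φᵢ` over `B(y, 2^{-j})` and using Prop. 3.1.5 (ii),
`‖Gⱼ‖_∞ ≤ 2ʲ C` (this is `BMO ⊂ Ḃ⁰_{∞,∞}`, Grafakos Thm. 3.3.8, estimate (3.3.18)). Hence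
`‖Δ̇ⱼ U‖_{L^∞} ≤ C 2ʲ` and `|⟨Ṡⱼ U, φ⟩| ≤ C 2ʲ ‖φ‖_{L¹} → 0` as `j → -∞`.

## Main results (all proved)

* `Literature.Analysis.FunctionSpaces.fourier_smulLeftCLM_fourierInv_apply`: kernel of a Fourier multiplier with Schwartz symbol,
  `𝓕(T · 𝓕⁻¹φ)(x) = ∫ 𝓕T(x - y) φ(y) dy`;
* `Literature.Analysis.FunctionSpaces.bmo_weighted_oscillation_le`: Grafakos' Prop. 3.1.5 (ii) at `δ = 1`;
* `Literature.Analysis.FunctionSpaces.MemBMO.norm_integral_kernel_mul_le`: `BMO ⊂ Ḃ⁰_{∞,∞}` in kernel form;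
* `Literature.Analysis.FunctionSpaces.HasWeakDivergenceRepresentation.integral_mul_eq_of_decay`,
  `Literature.Analysis.FunctionSpaces.HasWeakDivergenceRepresentation.integral_schwartz_mul_eq`: the weak divergence identity
  for decaying, resp. Schwartz, test functions;
* `Literature.Analysis.FunctionSpaces.MemBMOInv.exists_bounded_repr`: `ρ(2^{-j}D) U` is a bounded function of sup norm `≤ C 2ʲ`;
* `Literature.MemBMOInv.memHomBesov_neg_one_top_holds : MemBMOInv.memHomBesov_neg_one_top`.

## References

* H. Koch, D. Tataru, *Well-posedness for the Navier–Stokes equations*, Adv. Math. 157 (2001),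
  22–35, §1, Theorem 1 and (22). [KochTataruAdvMath2001]
* L. Grafakos, *Modern Fourier Analysis*, 3rd ed., GTM 250 (2014), Prop. 3.1.5, Thm. 3.3.8.
  [GrafakosMFA2014]
* P. G. Lemarié-Rieusset, *The Navier–Stokes Problem in the 21st Century* (2016), Ch. 9, p. 229.
  [LemarieRieusset2016]
* H. Bahouri, J.-Y. Chemin, R. Danchin, *Fourier Analysis and Nonlinear PDE* (2011), §2.
-/

noncomputable section

open MeasureTheory SchwartzMap FourierTransform RealInnerProductSpace Real Complex Metric Filter
  Topology
open scoped SchwartzMap ENNReal NNReal LineDeriv ContDiff FourierTransform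

namespace Literature.Analysis.FunctionSpaces

/-! ## Symbols: dilations and the derivative profile -/

section Symbols

variable {E : Type*} [NormedAddCommGroup E] [InnerProductSpace ℝ E]

/-- The dyadic dilate `ρ(2^{-j} ξ)` of a symbol profile `ρ` (BCD (2.5): `φ(2^{-j}D)`). [folklore] -/
def dilateSymbol (ρ : E → ℂ) (j : ℤ) (ξ : E) : ℂ := ρ (((2 : ℝ) ^ (-j)) • ξ)

/-- Unfolding `dilateSymbol`. [folklore] -/
theorem dilateSymbol_apply (ρ : E → ℂ) (j : ℤ) (ξ : E) :
    dilateSymbol ρ j ξ = ρ (((2 : ℝ) ^ (-j)) • ξ) := rfl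

/-- `φⱼ = φ₀(2^{-j}·)` for the dyadic symbols of `LittlewoodPaley.lean` (BCD (2.5)). [folklore] -/
theorem dyadicSymbol_eq_dilateSymbol (j : ℤ) :
    (dyadicSymbol j : E → ℂ) = dilateSymbol (dyadicSymbol 0) j := by
  ext ξ
  have h : (2 : ℝ) ^ (1 - j) = (2 : ℝ) ^ (1 - 0 : ℤ) * 2 ^ (-j) := by
    rw [← zpow_add₀ two_ne_zero]; ring_nf
  simp only [dyadicSymbol, dilateSymbol, smul_smul, neg_zero, zpow_zero, one_mul, h]

/-- `χⱼ = χ₀(2^{-j}·)` for the low-frequency symbols of `LittlewoodPaley.lean` (BCD (2.5)).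
[folklore] -/
theorem lowFreqSymbol_eq_dilateSymbol (j : ℤ) :
    (lowFreqSymbol j : E → ℂ) = dilateSymbol (lowFreqSymbol 0) j := by
  ext ξ
  simp [lowFreqSymbol, dilateSymbol]

/-- Dilates of smooth symbols are smooth (chain rule). [folklore] -/
theorem dilateSymbol_contDiff {ρ : E → ℂ} (hρ : ContDiff ℝ ∞ ρ) (j : ℤ) :
    ContDiff ℝ ∞ (dilateSymbol ρ j) :=
  hρ.comp (contDiff_const.smul contDiff_id)

/-- Dilates of compactly supported symbols are compactly supported. [folklore] -/
theorem dilateSymbol_hasCompactSupport [FiniteDimensional ℝ E] {ρ : E → ℂ}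
    (hρ : HasCompactSupport ρ) (j : ℤ) : HasCompactSupport (dilateSymbol ρ j) :=
  hρ.comp_homeomorph (Homeomorph.smulOfNeZero ((2 : ℝ) ^ (-j)) (zpow_ne_zero _ two_ne_zero))

/-- Dilates of smooth compactly supported symbols have temperate growth (so that the Fourier
multipliers of `LittlewoodPaley.lean` are not the junk value `0`). [folklore] -/
theorem dilateSymbol_hasTemperateGrowth [FiniteDimensional ℝ E] {ρ : E → ℂ} (hρ : ContDiff ℝ ∞ ρ)
    (hρc : HasCompactSupport ρ) (j : ℤ) : (dilateSymbol ρ j).HasTemperateGrowth :=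
  (dilateSymbol_hasCompactSupport hρc j).hasTemperateGrowth (dilateSymbol_contDiff hρ j)

/-- The symbol `τ(ξ) = -2πi ⟪ξ, m⟫ ρ(ξ)` of `∂ₘ ρ(D)` composed with the Fourier-side sign
convention of `SchwartzMap.lineDerivOp_fourier_eq`; it vanishes at the origin. [folklore] -/
def derivSymbol (ρ : E → ℂ) (m : E) (ξ : E) : ℂ := -(2 * π * I) * ((⟪ξ, m⟫ : ℂ) * ρ ξ)

/-- The derivative symbol vanishes at the origin (its kernel has mean zero). [folklore] -/
theorem derivSymbol_zero (ρ : E → ℂ) (m : E) : derivSymbol ρ m 0 = 0 := by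
  simp [derivSymbol]

/-- The derivative symbol of a smooth profile is smooth. [folklore] -/
theorem derivSymbol_contDiff {ρ : E → ℂ} (hρ : ContDiff ℝ ∞ ρ) (m : E) :
    ContDiff ℝ ∞ (derivSymbol ρ m) :=
  contDiff_const.mul
    ((ofRealCLM.contDiff.comp (contDiff_id.inner ℝ contDiff_const)).mul hρ)

/-- The derivative symbol of a compactly supported profile is compactly supported. [folklore] -/
theorem derivSymbol_hasCompactSupport {ρ : E → ℂ} (hρ : HasCompactSupport ρ) (m : E) :
    HasCompactSupport (derivSymbol ρ m) := by
  unfold derivSymbol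
  exact (hρ.mul_left).mul_left

/-- The symbol identity behind `∂ₘ ρ(2^{-j}D) = 2ʲ τ(2^{-j}D)`:
`-2πi ⟪ξ, m⟫ ρ(2^{-j}ξ) = 2ʲ τ(2^{-j}ξ)`. [folklore] -/
theorem inner_mul_dilateSymbol (ρ : E → ℂ) (m : E) (j : ℤ) :
    (-(2 * π * I)) • ((fun ξ : E => (⟪ξ, m⟫ : ℂ)) * dilateSymbol ρ j) =
      ((2 : ℂ) ^ j) • dilateSymbol (derivSymbol ρ m) j := by
  ext ξ
  simp only [Pi.smul_apply, Pi.mul_apply, dilateSymbol, derivSymbol, smul_eq_mul,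
    real_inner_smul_left, ofReal_mul]
  have h2 : ((2 : ℂ) ^ j) * ((2 : ℝ) ^ (-j) : ℝ) = 1 := by
    push_cast
    rw [← zpow_add₀ two_ne_zero]; simp
  linear_combination (2 * π * I) * (⟪ξ, m⟫ : ℂ) * ρ (((2 : ℝ) ^ (-j)) • ξ) * h2

end Symbols

/-! ## Fourier-side lemmas: derivative of a multiplier, kernels, dilations -/

section Fourier

variable {E : Type*} [NormedAddCommGroup E] [InnerProductSpace ℝ E] [FiniteDimensional ℝ E]
  [MeasurableSpace E] [BorelSpace E]

/-- `∂ₘ 𝓕(ρⱼ 𝓕⁻¹φ) = 2ʲ 𝓕(τⱼ 𝓕⁻¹φ)` on Schwartz functions, `τ = derivSymbol ρ m`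
(from `SchwartzMap.lineDerivOp_fourier_eq`). [folklore] -/
theorem lineDerivOp_fourier_smulLeftCLM_dilateSymbol {ρ : E → ℂ} (hρ : ContDiff ℝ ∞ ρ)
    (hρc : HasCompactSupport ρ) (m : E) (j : ℤ) (φ : 𝓢(E, ℂ)) :
    ∂_{m} (𝓕 (smulLeftCLM ℂ (dilateSymbol ρ j) (𝓕⁻ φ))) =
      ((2 : ℂ) ^ j) • 𝓕 (smulLeftCLM ℂ (dilateSymbol (derivSymbol ρ m) j) (𝓕⁻ φ)) := by
  rw [lineDerivOp_fourier_eq]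
  have h1 : (fun x : E => ⟪x, m⟫).HasTemperateGrowth := by fun_prop
  have h1' : (fun x : E => (⟪x, m⟫ : ℂ)).HasTemperateGrowth := by fun_prop
  have h2 : (dilateSymbol ρ j).HasTemperateGrowth := dilateSymbol_hasTemperateGrowth hρ hρc j
  have h3 : (dilateSymbol (derivSymbol ρ m) j).HasTemperateGrowth :=
    dilateSymbol_hasTemperateGrowth (derivSymbol_contDiff hρ m)
      (derivSymbol_hasCompactSupport hρc m) j
  have key : ∀ X : 𝓢(E, ℂ), (smulLeftCLM ℂ fun x : E => ⟪x, m⟫) X =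
      smulLeftCLM ℂ (fun x : E => (⟪x, m⟫ : ℂ)) X := fun X => (smulLeftCLM_ofReal ℂ h1 X).symm
  rw [key, smulLeftCLM_smulLeftCLM_apply h1' h2, ← smul_apply, ← smulLeftCLM_smul (h1'.mul h2),
    inner_mul_dilateSymbol ρ m j, smulLeftCLM_smul h3, smul_apply, fourier_smul]

/-- **Kernel of a Fourier multiplier with Schwartz symbol**: `𝓕(T · 𝓕⁻¹φ)(x) = ∫ 𝓕T(x - y) φ(y) dy`
(the convolution theorem; Fubini on `e^{-2πi⟨ξ, x - y⟩} T(ξ) φ(y)`). [folklore] -/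
theorem fourier_smulLeftCLM_fourierInv_apply (T φ : 𝓢(E, ℂ)) (x : E) :
    𝓕 (smulLeftCLM ℂ (⇑T) (𝓕⁻ φ)) x = ∫ y, 𝓕 T (x - y) * φ y := by
  rw [fourier_coe, Real.fourier_eq]
  simp only [smulLeftCLM_apply_apply T.hasTemperateGrowth, fourierInv_coe, Real.fourierInv_eq,
    smul_eq_mul, Circle.smul_def]
  have hT : ∀ y, 𝓕 T (x - y) = ∫ ξ, 𝐞 (-⟪ξ, x - y⟫) * T ξ := fun y => by
    rw [fourier_coe, Real.fourier_eq]; simp [Circle.smul_def]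
  simp_rw [hT]
  set F : E → E → ℂ := fun ξ y => (𝐞 (-⟪ξ, x⟫) : ℂ) * (𝐞 ⟪y, ξ⟫ : ℂ) * (T ξ * φ y) with hF
  have hF_int : Integrable (Function.uncurry F) (volume.prod volume) := by
    have h1 : Integrable (fun p : E × E => T p.1 * φ p.2) (volume.prod volume) :=
      T.integrable.mul_prod φ.integrable
    refine h1.bdd_mul (c := 1) ?_ (Filter.Eventually.of_forall fun p => ?_)
    · have : Continuous fun p : E × E => (𝐞 (-⟪p.1, x⟫) : ℂ) * (𝐞 ⟪p.2, p.1⟫ : ℂ) := by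
        fun_prop
      exact this.aestronglyMeasurable
    · simp only [norm_mul, Circle.norm_coe, mul_one, le_refl]
  calc ∫ ξ, (𝐞 (-⟪ξ, x⟫) : ℂ) * (T ξ * ∫ y, (𝐞 ⟪y, ξ⟫ : ℂ) * φ y)
      = ∫ ξ, ∫ y, F ξ y := by
        congr 1 with ξ
        simp only [hF, ← integral_const_mul]
        congr 1 with y; ring
    _ = ∫ y, ∫ ξ, F ξ y := integral_integral_swap hF_int
    _ = ∫ y, (∫ ξ, (𝐞 (-⟪ξ, x - y⟫) : ℂ) * T ξ) * φ y := by
        congr 1 with y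
        rw [← integral_mul_const]
        congr 1 with ξ
        have he : (𝐞 (-⟪ξ, x - y⟫) : ℂ) = 𝐞 (-⟪ξ, x⟫) * 𝐞 ⟪ξ, y⟫ := by
          rw [inner_sub_right, show -(⟪ξ, x⟫ - ⟪ξ, y⟫) = -⟪ξ, x⟫ + ⟪ξ, y⟫ by ring,
            AddChar.map_add_eq_mul, Circle.coe_mul]
        simp only [hF, real_inner_comm ξ y, he]
        ring

/-- `∫ 𝓕 T = T(0)` for a Schwartz function `T` (Fourier inversion at the origin). [folklore] -/
theorem integral_fourier_schwartz_eq_apply_zero (T : 𝓢(E, ℂ)) : ∫ x, 𝓕 T x = T 0 := by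
  have h : (𝓕⁻ (𝓕 T) : 𝓢(E, ℂ)) 0 = T 0 := by
    rw [(FourierTransform.fourierInv_fourier_eq T : 𝓕⁻ (𝓕 T) = T)]
  rw [← h, fourierInv_coe, Real.fourierInv_eq]
  simp

/-- Fourier transform of a dilate: `𝓕(ρ(c⁻¹·))(z) = |c|ᵈ 𝓕ρ(c z)` for `c ≠ 0`. [folklore] -/
theorem fourier_comp_inv_smul (ρ : E → ℂ) {c : ℝ} (hc : c ≠ 0) (z : E) :
    𝓕 (fun ξ => ρ (c⁻¹ • ξ)) z = ((|c| ^ Module.finrank ℝ E : ℝ) : ℂ) * 𝓕 ρ (c • z) := by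
  rw [Real.fourier_eq, Real.fourier_eq]
  have key := Measure.integral_comp_smul volume (fun η : E => 𝐞 (-⟪η, c • z⟫) • ρ η) c⁻¹
  simp only [real_inner_smul_left, real_inner_smul_right, ← mul_assoc, mul_inv_cancel₀ hc,
    one_mul] at key ⊢
  rw [key, inv_pow, inv_inv, abs_pow, Complex.real_smul]

omit [FiniteDimensional ℝ E] [MeasurableSpace E] [BorelSpace E] in
/-- Pointwise decay of a Schwartz function: `‖K(w)‖ ≤ 2ᴺ p_N(K) (1 + ‖w‖)^{-N}` with `p_N` the
sup of the Schwartz seminorms of index `≤ (N, 0)`. [folklore] -/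
theorem norm_le_seminorm_mul_inv_one_add_pow (K : 𝓢(E, ℂ)) (N : ℕ) (w : E) :
    ‖K w‖ ≤ 2 ^ N * ((Finset.Iic (N, 0)).sup fun m => SchwartzMap.seminorm ℝ m.1 m.2) K *
      ((1 + ‖w‖) ^ N)⁻¹ := by
  have h := one_add_le_sup_seminorm_apply (𝕜 := ℝ) (m := (N, 0)) le_rfl le_rfl K w
  rw [norm_iteratedFDeriv_zero] at h
  have hpos : 0 < (1 + ‖w‖) ^ N := by positivity
  rw [le_mul_inv_iff₀ hpos]
  linarith [h]

end Fourier

variable {E : Type*} [NormedAddCommGroup E] [InnerProductSpace ℝ E] [FiniteDimensional ℝ E]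
  [MeasurableSpace E] [BorelSpace E]

/-! ## Weighted oscillation of `BMO` functions: Grafakos' Prop. 3.1.5 (ii) -/

section Oscillation

omit [InnerProductSpace ℝ E] [FiniteDimensional ℝ E] [MeasurableSpace E] [BorelSpace E] in
/-- Everywhere, the weight `R (R + |x - x₀|)^{-d-1}` of (3.1.5) is at most `R^{-d}`. [folklore] -/
theorem bmoWeight_le_inv_pow (x₀ : E) {R : ℝ} (hR : 0 < R) (d : ℕ) (x : E) :
    R * ((R + ‖x - x₀‖) ^ (d + 1))⁻¹ ≤ (R ^ d)⁻¹ := by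
  have h1 : R ^ (d + 1) ≤ (R + ‖x - x₀‖) ^ (d + 1) :=
    pow_le_pow_left₀ hR.le (le_add_of_nonneg_right (norm_nonneg _)) _
  have h2 : ((R + ‖x - x₀‖) ^ (d + 1))⁻¹ ≤ (R ^ (d + 1))⁻¹ := inv_anti₀ (by positivity) h1
  calc R * ((R + ‖x - x₀‖) ^ (d + 1))⁻¹ ≤ R * (R ^ (d + 1))⁻¹ := by gcongr
    _ = (R ^ d)⁻¹ := by rw [pow_succ]; field_simp

omit [InnerProductSpace ℝ E] [FiniteDimensional ℝ E] [MeasurableSpace E] [BorelSpace E] in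
/-- Off `B(x₀, R)`, the weight `R (R + |x - x₀|)^{-d-1}` of (3.1.5) is at most `R |x - x₀|^{-d-1}`.
[folklore] -/
theorem bmoWeight_le_mul_inv_norm_pow (x₀ : E) {R : ℝ} (hR : 0 < R) (d : ℕ)
    {x : E} (hx : x ∈ (ball x₀ R)ᶜ) :
    R * ((R + ‖x - x₀‖) ^ (d + 1))⁻¹ ≤ R * (‖x - x₀‖ ^ (d + 1))⁻¹ := by
  rw [Set.mem_compl_iff, mem_ball_iff_norm, not_lt] at hx
  have hx0 : 0 < ‖x - x₀‖ := hR.trans_le hx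
  have h1 : ‖x - x₀‖ ^ (d + 1) ≤ (R + ‖x - x₀‖) ^ (d + 1) :=
    pow_le_pow_left₀ hx0.le (le_add_of_nonneg_left hR.le) _
  exact mul_le_mul_of_nonneg_left (inv_anti₀ (by positivity) h1) hR.le

/-- The inner part of Grafakos' (3.1.5): `∫_{B(x₀,R)} |f - f_{B(x₀,R)}| w_{x₀,R} ≤ |B(0,1)| ‖f‖_*`,
since the weight is `≤ R^{-d}` and `∫_B |f - f_B| ≤ ‖f‖_* |B|` (Grafakos, proof of Prop. 3.1.5 (ii),
first display). [cite: GrafakosMFA2014, Proposition 3.1.5 (ii), proof] -/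
theorem MemBMO.lintegral_ball_enorm_sub_average_mul_weight_le {f : E → ℝ} (hf : MemBMO f)
    (x₀ : E) {R : ℝ} (hR : 0 < R) :
    ∫⁻ x in ball x₀ R, ‖f x - ⨍ y in ball x₀ R, f y‖ₑ *
        ENNReal.ofReal (R * ((R + ‖x - x₀‖) ^ (Module.finrank ℝ E + 1))⁻¹) ≤
      ENNReal.ofReal (volume.real (ball (0 : E) 1) * (eBMOSeminorm f).toReal) := by
  obtain ⟨d, hd⟩ : ∃ d : ℕ, d = Module.finrank ℝ E := ⟨_, rfl⟩
  rw [← hd]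
  have hRd : (0 : ℝ) < R ^ d := pow_pos hR d
  have step1 : ∫⁻ x in ball x₀ R, ‖f x - ⨍ y in ball x₀ R, f y‖ₑ *
        ENNReal.ofReal (R * ((R + ‖x - x₀‖) ^ (d + 1))⁻¹)
      ≤ ∫⁻ x in ball x₀ R, ‖f x - ⨍ y in ball x₀ R, f y‖ₑ * ENNReal.ofReal ((R ^ d)⁻¹) := by
    refine lintegral_mono fun x => ?_
    gcongr
    exact bmoWeight_le_inv_pow x₀ hR d x
  have step2 : ∫⁻ x in ball x₀ R, ‖f x - ⨍ y in ball x₀ R, f y‖ₑ * ENNReal.ofReal ((R ^ d)⁻¹) =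
      (∫⁻ x in ball x₀ R, ‖f x - ⨍ y in ball x₀ R, f y‖ₑ) * ENNReal.ofReal ((R ^ d)⁻¹) :=
    lintegral_mul_const' _ _ ENNReal.ofReal_ne_top
  have step3 : ∫⁻ x in ball x₀ R, ‖f x - ⨍ y in ball x₀ R, f y‖ₑ ≤
      ENNReal.ofReal ((eBMOSeminorm f).toReal * volume.real (ball x₀ R)) := by
    have h := hf.lintegral_ball_enorm_sub_average_le x₀ hR 0
    have e1 : (2 : ℝ) ^ (0 : ℕ) * R = R := by rw [pow_zero, one_mul]
    have e2 : (1 + ((0 : ℕ) : ℝ) * 2 ^ Module.finrank ℝ E) = 1 := by simp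
    rw [e1, e2, one_mul] at h
    exact h
  have step4 : ENNReal.ofReal ((eBMOSeminorm f).toReal * volume.real (ball x₀ R)) *
        ENNReal.ofReal ((R ^ d)⁻¹) =
      ENNReal.ofReal (volume.real (ball (0 : E) 1) * (eBMOSeminorm f).toReal) := by
    rw [← ENNReal.ofReal_mul' (by positivity), volumeReal_ball_eq_pow_mul x₀ hR, ← hd]
    congr 1
    field_simp
  rw [step2] at step1
  refine step1.trans (le_of_le_of_eq ?_ step4)
  gcongr

/-- The outer part of Grafakos' (3.1.5): `∫_{B(x₀,R)ᶜ} |f - f_{B(x₀,R)}| w_{x₀,R} ≤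
2^{d+1} (1 + 2^{d+1}) |B(0,1)| ‖f‖_*`, since off the ball the weight is `≤ R |x - x₀|^{-d-1}` and
the dyadic-shell tail estimate `MemBMO.lintegral_compl_ball_enorm_sub_average_mul_le`
(`BMOCarlesonFeffermanStein.lean`) applies (Grafakos, proof of Prop. 3.1.5 (ii), the sum over
`2^{k+1}B ∖ 2^k B`). [cite: GrafakosMFA2014, Proposition 3.1.5 (ii), proof] -/
theorem MemBMO.lintegral_compl_ball_enorm_sub_average_mul_weight_le {f : E → ℝ} (hf : MemBMO f)
    (x₀ : E) {R : ℝ} (hR : 0 < R) :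
    ∫⁻ x in (ball x₀ R)ᶜ, ‖f x - ⨍ y in ball x₀ R, f y‖ₑ *
        ENNReal.ofReal (R * ((R + ‖x - x₀‖) ^ (Module.finrank ℝ E + 1))⁻¹) ≤
      ENNReal.ofReal (2 ^ (Module.finrank ℝ E + 1) * (1 + 2 ^ (Module.finrank ℝ E + 1)) *
        volume.real (ball (0 : E) 1) * (eBMOSeminorm f).toReal) := by
  obtain ⟨d, hd⟩ : ∃ d : ℕ, d = Module.finrank ℝ E := ⟨_, rfl⟩
  rw [← hd]
  have step1 : ∫⁻ x in (ball x₀ R)ᶜ, ‖f x - ⨍ y in ball x₀ R, f y‖ₑ *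
        ENNReal.ofReal (R * ((R + ‖x - x₀‖) ^ (d + 1))⁻¹)
      ≤ ∫⁻ x in (ball x₀ R)ᶜ, ENNReal.ofReal R * (‖f x - ⨍ y in ball x₀ R, f y‖ₑ *
          ENNReal.ofReal ((‖x - x₀‖ ^ (d + 1))⁻¹)) := by
    refine setLIntegral_mono' measurableSet_ball.compl fun x hx => ?_
    have e : ENNReal.ofReal R * (‖f x - ⨍ y in ball x₀ R, f y‖ₑ *
        ENNReal.ofReal ((‖x - x₀‖ ^ (d + 1))⁻¹)) = ‖f x - ⨍ y in ball x₀ R, f y‖ₑ *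
        ENNReal.ofReal (R * (‖x - x₀‖ ^ (d + 1))⁻¹) := by
      rw [ENNReal.ofReal_mul hR.le]; ring
    rw [e]
    gcongr _ * ENNReal.ofReal ?_
    exact bmoWeight_le_mul_inv_norm_pow x₀ hR d hx
  have step2 : ∫⁻ x in (ball x₀ R)ᶜ, ENNReal.ofReal R * (‖f x - ⨍ y in ball x₀ R, f y‖ₑ *
          ENNReal.ofReal ((‖x - x₀‖ ^ (d + 1))⁻¹)) =
      ENNReal.ofReal R * ∫⁻ x in (ball x₀ R)ᶜ, ‖f x - ⨍ y in ball x₀ R, f y‖ₑ *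
          ENNReal.ofReal ((‖x - x₀‖ ^ (d + 1))⁻¹) :=
    lintegral_const_mul' _ _ ENNReal.ofReal_ne_top
  have step3 := hf.lintegral_compl_ball_enorm_sub_average_mul_le x₀ hR
  rw [← hd] at step3
  have step4 : ENNReal.ofReal R * ENNReal.ofReal (2 ^ (d + 1) * (1 + 2 ^ (d + 1)) *
        volume.real (ball (0 : E) 1) * (eBMOSeminorm f).toReal / R) =
      ENNReal.ofReal (2 ^ (d + 1) * (1 + 2 ^ (d + 1)) *
        volume.real (ball (0 : E) 1) * (eBMOSeminorm f).toReal) := by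
    rw [← ENNReal.ofReal_mul hR.le]
    congr 1
    field_simp
  rw [step2] at step1
  refine step1.trans (le_of_le_of_eq ?_ step4)
  gcongr

/-- **BMO functions have controlled weighted oscillation** (Grafakos, *Modern Fourier Analysis*,
3rd ed., Prop. 3.1.5 (ii), the case `δ = 1`, balls version): there is a dimensional constant `C`
(here `C = (1 + 2^{d+1} (1 + 2^{d+1})) |B(0,1)|`) such that for every `f ∈ BMO(ℝᵈ)`, every `x₀`
and every `R > 0`, `R ∫ |f(x) - Avg_{B(x₀,R)} f| / (R + |x - x₀|)^{d+1} dx ≤ C ‖f‖_{BMO}`.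
Stated with the `ℝ≥0∞`-valued integral and the seminorm `eBMOSeminorm` of `BMO.lean` (balls, as in
Grafakos' `‖·‖_{BMO_balls}`, (3.1.2)). Proof as printed: split the integral into the ball
`B(x₀, R)` and its complement and use the two previous lemmas (the dyadic shells being summed in
`MemBMO.lintegral_compl_ball_enorm_sub_average_mul_le`).
[cite: GrafakosMFA2014, Proposition 3.1.5 (ii)] -/
theorem bmo_weighted_oscillation_le :
    ∃ C : ℝ≥0, ∀ (f : E → ℝ), MemBMO f → ∀ (x₀ : E) (R : ℝ), 0 < R →
      ∫⁻ x, ‖f x - ⨍ y in ball x₀ R, f y‖ₑ *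
          ENNReal.ofReal (R * ((R + ‖x - x₀‖) ^ (Module.finrank ℝ E + 1))⁻¹) ≤
        C * eBMOSeminorm f := by
  obtain ⟨d, hd⟩ : ∃ d : ℕ, d = Module.finrank ℝ E := ⟨_, rfl⟩
  obtain ⟨V, hV⟩ : ∃ V : ℝ, V = volume.real (ball (0 : E) 1) := ⟨_, rfl⟩
  have hV0 : 0 ≤ V := hV ▸ measureReal_nonneg
  refine ⟨(V + 2 ^ (d + 1) * (1 + 2 ^ (d + 1)) * V).toNNReal, fun f hf x₀ R hR => ?_⟩
  have hS : ENNReal.ofReal (eBMOSeminorm f).toReal = eBMOSeminorm f :=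
    ENNReal.ofReal_toReal hf.eBMOSeminorm_lt_top.ne
  have h1 := hf.lintegral_ball_enorm_sub_average_mul_weight_le x₀ hR
  have h2 := hf.lintegral_compl_ball_enorm_sub_average_mul_weight_le x₀ hR
  rw [← hd, ← hV] at h1 h2
  rw [← lintegral_add_compl _ (measurableSet_ball (x := x₀) (ε := R)), ← hd]
  refine (add_le_add h1 h2).trans_eq ?_
  rw [← ENNReal.ofReal_add (by positivity) (by positivity), ← hS, ENNReal.ofReal_coe_nnreal.symm,
    Real.coe_toNNReal _ (by positivity), ← ENNReal.ofReal_mul (by positivity),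
    ENNReal.toReal_ofReal ENNReal.toReal_nonneg]
  congr 1
  ring

end Oscillation

/-! ## Consequences of the weighted oscillation estimate -/

section Tempered

/-- The weight `w_{x₀,t}(x) = t (t + |x - x₀|)^{-d-1}` of Grafakos' (3.1.5) with `δ = 1`; it has
the scaling of an approximate identity, `w_{x₀,t} = t^{-d} w_{0,1}((· - x₀)/t)`. [folklore] -/
def bmoWeight (x₀ : E) (t : ℝ) (x : E) : ℝ :=
  t * ((t + ‖x - x₀‖) ^ (Module.finrank ℝ E + 1))⁻¹

omit [FiniteDimensional ℝ E] [MeasurableSpace E] [BorelSpace E] in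
/-- The weight is nonnegative for `t ≥ 0`. [folklore] -/
theorem bmoWeight_nonneg (x₀ : E) {t : ℝ} (ht : 0 ≤ t) (x : E) : 0 ≤ bmoWeight x₀ t x := by
  unfold bmoWeight; positivity

omit [FiniteDimensional ℝ E] [MeasurableSpace E] [BorelSpace E] in
/-- The weight is continuous for `t > 0`. [folklore] -/
theorem continuous_bmoWeight (x₀ : E) {t : ℝ} (ht : 0 < t) : Continuous (bmoWeight x₀ t) := by
  unfold bmoWeight
  refine continuous_const.mul (Continuous.inv₀ (by fun_prop) fun x => ?_)
  positivity

omit [FiniteDimensional ℝ E] [MeasurableSpace E] [BorelSpace E] in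
/-- At the unit scale the weight is `(1 + |x|)^{-d-1}`. [folklore] -/
theorem bmoWeight_zero_one (x : E) :
    bmoWeight 0 1 x = ((1 + ‖x‖) ^ (Module.finrank ℝ E + 1))⁻¹ := by
  simp [bmoWeight]

/-- For `f ∈ BMO`, `(f - f_{B(x₀,t)}) w_{x₀,t}` is integrable with
`∫ |f - f_B| w ≤ C ‖f‖_*` (a reformulation of `bmo_weighted_oscillation_le`). [folklore] -/
theorem MemBMO.integrable_sub_average_mul_bmoWeight :
    ∃ C : ℝ≥0, ∀ (f : E → ℝ), MemBMO f → ∀ (x₀ : E) (t : ℝ), 0 < t →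
      Integrable (fun x => (f x - ⨍ y in ball x₀ t, f y) * bmoWeight x₀ t x) ∧
        ∫ x, ‖(f x - ⨍ y in ball x₀ t, f y) * bmoWeight x₀ t x‖ ≤ C * (eBMOSeminorm f).toReal := by
  obtain ⟨C, hC⟩ := bmo_weighted_oscillation_le (E := E)
  refine ⟨C, fun f hf x₀ t ht => ?_⟩
  have hosc := hC f hf x₀ t ht
  obtain ⟨c, hc⟩ : ∃ c, (⨍ y in ball x₀ t, f y) = c := ⟨_, rfl⟩
  simp only [hc] at hosc ⊢
  have hmeas : AEStronglyMeasurable (fun x => (f x - c) * bmoWeight x₀ t x) volume :=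
    (hf.locallyIntegrable.aestronglyMeasurable.sub aestronglyMeasurable_const).mul
      (continuous_bmoWeight x₀ ht).aestronglyMeasurable
  have henorm : ∀ x, ‖(f x - c) * bmoWeight x₀ t x‖ₑ =
      ‖f x - c‖ₑ * ENNReal.ofReal (t * ((t + ‖x - x₀‖) ^ (Module.finrank ℝ E + 1))⁻¹) := fun x => by
    rw [enorm_mul, Real.enorm_eq_ofReal (bmoWeight_nonneg x₀ ht.le x), bmoWeight]
  have hlint : ∫⁻ x, ‖(f x - c) * bmoWeight x₀ t x‖ₑ ≤ C * eBMOSeminorm f :=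
    (lintegral_congr fun x => henorm x).trans_le hosc
  have hfin : (C : ℝ≥0∞) * eBMOSeminorm f < ⊤ :=
    ENNReal.mul_lt_top ENNReal.coe_lt_top hf.eBMOSeminorm_lt_top
  refine ⟨⟨hmeas, hlint.trans_lt hfin⟩, ?_⟩
  rw [integral_norm_eq_lintegral_enorm hmeas]
  refine (ENNReal.toReal_mono hfin.ne hlint).trans_eq ?_
  rw [ENNReal.toReal_mul, ENNReal.coe_toReal]

/-- **`BMO` functions are tempered**: for `f ∈ BMO(ℝᵈ)`, `|f| (1 + |x|)^{-d-1} ∈ L¹`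
(Grafakos Prop. 3.1.5 (ii) at the unit ball plus integrability of the weight; this is the
hypothesis of Prop. 3.1.5 (iv)). A reformulation of `MemBMO.integrable_one_add_norm_pow_inv_mul`
of `BMOCarlesonProofs.lean`. [cite: GrafakosMFA2014, Prop. 3.1.5] -/
theorem MemBMO.integrable_norm_mul_inv_one_add_norm_pow {f : E → ℝ} (hf : MemBMO f) :
    Integrable fun x => ‖f x‖ * ((1 + ‖x‖) ^ (Module.finrank ℝ E + 1))⁻¹ := by
  refine hf.integrable_one_add_norm_pow_inv_mul.norm.congr (ae_of_all _ fun x => ?_)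
  simp only
  rw [norm_mul, norm_inv, norm_pow, Real.norm_of_nonneg (by positivity : (0 : ℝ) ≤ 1 + ‖x‖),
    mul_comm]

/-- A polynomially integrable function is integrable against Schwartz functions. [folklore] -/
theorem integrable_ofReal_mul_schwartz {f : E → ℝ} {N : ℕ} (hf : AEStronglyMeasurable f volume)
    (hfw : Integrable fun x => ‖f x‖ * ((1 + ‖x‖) ^ N)⁻¹) (θ : 𝓢(E, ℂ)) :
    Integrable fun x => (f x : ℂ) * θ x := by
  set S := 2 ^ N * ((Finset.Iic (N, 0)).sup fun m => SchwartzMap.seminorm ℝ m.1 m.2) θ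
  refine (hfw.const_mul S).mono' (by fun_prop) (ae_of_all _ fun x => ?_)
  have hθ := norm_le_seminorm_mul_inv_one_add_pow θ N x
  calc ‖(f x : ℂ) * θ x‖ = ‖f x‖ * ‖θ x‖ := by rw [norm_mul, Complex.norm_real]
    _ ≤ ‖f x‖ * (S * ((1 + ‖x‖) ^ N)⁻¹) := by gcongr
    _ = S * (‖f x‖ * ((1 + ‖x‖) ^ N)⁻¹) := by ring

end Tempered

/-! ## `BMO ⊂ Ḃ⁰_{∞,∞}` in kernel form -/

section CoreEstimate

omit [FiniteDimensional ℝ E] [MeasurableSpace E] [BorelSpace E] in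
/-- The constant `2ᴺ sup_{(k,n) ≤ (N,0)} p_{k,n}(K)` controlling `(1 + |w|)ᴺ |K(w)|`. [folklore] -/
theorem schwartz_decay_const_nonneg (K : 𝓢(E, ℂ)) (N : ℕ) :
    0 ≤ 2 ^ N * ((Finset.Iic (N, 0)).sup fun m => SchwartzMap.seminorm ℝ m.1 m.2) K := by
  positivity

omit [FiniteDimensional ℝ E] [MeasurableSpace E] [BorelSpace E] in
/-- Scaling of the BMO weight: `aᵈ (1 + a|x - y|)^{-d-1} = w_{y,1/a}(x)`. [folklore] -/
theorem pow_mul_inv_one_add_mul_pow_eq_bmoWeight {a : ℝ} (ha : 0 < a) (y x : E) :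
    a ^ Module.finrank ℝ E * ((1 + a * ‖x - y‖) ^ (Module.finrank ℝ E + 1))⁻¹ =
      bmoWeight y a⁻¹ x := by
  unfold bmoWeight
  have : a⁻¹ + ‖x - y‖ = a⁻¹ * (1 + a * ‖x - y‖) := by field_simp
  rw [this, mul_pow, mul_inv, inv_pow, inv_inv, ← mul_assoc, pow_succ]
  field_simp
  ring

/-- **`BMO ⊂ Ḃ⁰_{∞,∞}` in kernel form** (Grafakos, *Modern Fourier Analysis*, Thm. 3.3.8 and its
proof, estimate (3.3.18) combined with Prop. 3.1.5 (ii)): for a Schwartz kernel `K` of mean zero,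
`f ∈ BMO`, `a > 0` and `y ∈ ℝᵈ`,
`|∫ aᵈ K(a(x - y)) f(x) dx| ≤ C_d p(K) ‖f‖_{BMO}`, uniformly in the scale `a` and the point `y`
(subtract the average of `f` over `B(y, 1/a)`, which is killed by the mean-zero kernel, and bound
the kernel by the weight of Prop. 3.1.5 (ii)). Here `p(K) = 2^{d+1} sup_{k ≤ d+1} p_{k,0}(K)`.
[cite: GrafakosMFA2014, Thm. 3.3.8 (3.3.18)] -/
theorem MemBMO.norm_integral_kernel_mul_le :
    ∃ C : ℝ≥0, ∀ (K : 𝓢(E, ℂ)), (∫ x, K x) = 0 → ∀ (f : E → ℝ), MemBMO f → ∀ (a : ℝ), 0 < a →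
      ∀ y : E, ‖∫ x, ((a ^ Module.finrank ℝ E : ℝ) : ℂ) * K (a • (x - y)) * f x‖ ≤
        C * (2 ^ (Module.finrank ℝ E + 1) *
          ((Finset.Iic (Module.finrank ℝ E + 1, 0)).sup
            fun m => SchwartzMap.seminorm ℝ m.1 m.2) K) *
          (eBMOSeminorm f).toReal := by
  obtain ⟨C, hC⟩ := MemBMO.integrable_sub_average_mul_bmoWeight (E := E)
  refine ⟨C, fun K hK f hf a ha y => ?_⟩
  have ht : 0 < a⁻¹ := inv_pos.mpr ha
  obtain ⟨hint, hle⟩ := hC f hf y a⁻¹ ht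
  obtain ⟨c, hc⟩ : ∃ c, (⨍ z in ball y a⁻¹, f z) = c := ⟨_, rfl⟩
  rw [hc] at hint hle
  obtain ⟨S, hS⟩ : ∃ S : ℝ, 2 ^ (Module.finrank ℝ E + 1) *
    ((Finset.Iic (Module.finrank ℝ E + 1, 0)).sup fun m => SchwartzMap.seminorm ℝ m.1 m.2) K = S :=
    ⟨_, rfl⟩
  have hS0 : 0 ≤ S := hS ▸ schwartz_decay_const_nonneg K _
  rw [hS]
  -- the rescaled kernel
  obtain ⟨Ka, hKa⟩ : ∃ Ka : E → ℂ,
      (fun x => ((a ^ Module.finrank ℝ E : ℝ) : ℂ) * K (a • (x - y))) = Ka := ⟨_, rfl⟩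
  have hKa_cont : Continuous Ka := by
    rw [← hKa]
    exact continuous_const.mul
      (K.continuous.comp (continuous_const.smul (continuous_id.sub continuous_const)))
  have hKa_bound : ∀ x, ‖Ka x‖ ≤ S * bmoWeight y a⁻¹ x := fun x => by
    rw [← hKa]
    simp only [norm_mul, Complex.norm_real, Real.norm_of_nonneg (pow_nonneg ha.le _)]
    have hK := norm_le_seminorm_mul_inv_one_add_pow K (Module.finrank ℝ E + 1) (a • (x - y))
    rw [norm_smul, Real.norm_of_nonneg ha.le, hS] at hK
    calc a ^ Module.finrank ℝ E * ‖K (a • (x - y))‖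
        ≤ a ^ Module.finrank ℝ E * (S * ((1 + a * ‖x - y‖) ^ (Module.finrank ℝ E + 1))⁻¹) := by
          gcongr
      _ = S * (a ^ Module.finrank ℝ E * ((1 + a * ‖x - y‖) ^ (Module.finrank ℝ E + 1))⁻¹) := by
          ring
      _ = S * bmoWeight y a⁻¹ x := by rw [pow_mul_inv_one_add_mul_pow_eq_bmoWeight ha]
  have hf_meas : AEStronglyMeasurable (fun x => (f x : ℂ)) volume :=
    Complex.continuous_ofReal.comp_aestronglyMeasurable hf.locallyIntegrable.aestronglyMeasurable
  have hptwise : ∀ x, ‖Ka x * ((f x : ℂ) - c)‖ ≤ S * ‖(f x - c) * bmoWeight y a⁻¹ x‖ := fun x => by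
    rw [norm_mul, ← Complex.ofReal_sub, Complex.norm_real, norm_mul,
      Real.norm_of_nonneg (bmoWeight_nonneg y ht.le x)]
    calc ‖Ka x‖ * ‖f x - c‖ ≤ S * bmoWeight y a⁻¹ x * ‖f x - c‖ := by
          gcongr; exact hKa_bound x
      _ = S * (‖f x - c‖ * bmoWeight y a⁻¹ x) := by ring
  -- integrability of the two pieces
  have hI1 : Integrable fun x => Ka x * ((f x : ℂ) - c) :=
    (hint.norm.const_mul S).mono' (hKa_cont.aestronglyMeasurable.mul
      (hf_meas.sub aestronglyMeasurable_const)) (ae_of_all _ hptwise)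
  have hI2 : Integrable fun x => Ka x * (c : ℂ) := by
    have : Integrable (fun x => K (a • (x - y))) :=
      (K.integrable.comp_smul ha.ne').comp_sub_right y
    rw [← hKa]
    exact (this.const_mul _).mul_const _
  have hzero : ∫ x, Ka x * (c : ℂ) = 0 := by
    rw [← hKa, integral_mul_const, integral_const_mul]
    have h := integral_sub_right_eq_self (μ := (volume : Measure E)) (fun x => K (a • x)) y
    rw [h, Measure.integral_comp_smul, hK, smul_zero, mul_zero, zero_mul]
  have hsplit : ∫ x, Ka x * (f x : ℂ) = ∫ x, Ka x * ((f x : ℂ) - c) := by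
    have : (fun x => Ka x * (f x : ℂ)) = fun x => Ka x * ((f x : ℂ) - c) + Ka x * (c : ℂ) := by
      ext x; ring
    rw [this, integral_add hI1 hI2, hzero, add_zero]
  have hgoal : (fun x => ((a ^ Module.finrank ℝ E : ℝ) : ℂ) * K (a • (x - y)) * f x) =
      fun x => Ka x * (f x : ℂ) := by rw [← hKa]
  rw [hgoal, hsplit]
  have hstep : ‖∫ x, Ka x * ((f x : ℂ) - c)‖ ≤ ∫ x, S * ‖(f x - c) * bmoWeight y a⁻¹ x‖ :=
    norm_integral_le_of_norm_le (hint.norm.const_mul S) (ae_of_all _ hptwise)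
  rw [integral_const_mul] at hstep
  refine hstep.trans ?_
  rw [show (C : ℝ) * S * (eBMOSeminorm f volume).toReal =
    S * (C * (eBMOSeminorm f volume).toReal) by ring]
  exact mul_le_mul_of_nonneg_left hle hS0

end CoreEstimate

/-! ## Fubini and measurability for Schwartz kernels -/

section Fubini

omit [InnerProductSpace ℝ E] [FiniteDimensional ℝ E] [MeasurableSpace E] [BorelSpace E] in
/-- Peetre's inequality `(1 + |x - y|)^{-N} ≤ (1 + |y|)ᴺ (1 + |x|)^{-N}`. [folklore] -/
theorem inv_one_add_norm_sub_pow_le (x y : E) (N : ℕ) :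
    ((1 + ‖x - y‖) ^ N)⁻¹ ≤ (1 + ‖y‖) ^ N * ((1 + ‖x‖) ^ N)⁻¹ := by
  have hx : 0 < (1 + ‖x‖) ^ N := by positivity
  have hxy : 0 < (1 + ‖x - y‖) ^ N := by positivity
  rw [inv_le_comm₀ hxy (by positivity), mul_inv, inv_inv, ← div_eq_inv_mul,
    div_le_iff₀ (by positivity), ← mul_pow]
  apply pow_le_pow_left₀ (by positivity)
  have := norm_le_norm_sub_add x y  -- ‖x‖ ≤ ‖x - y‖ + ‖y‖
  nlinarith [norm_nonneg (x - y), norm_nonneg y]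

/-- Weighted `L¹` bound for the convolution of two Schwartz functions against the Peetre weight:
`∫ |K(x - y)| |φ(y)| dy ≤ p(K) I(φ) (1 + |x|)^{-N}`. [folklore] -/
theorem integral_norm_kernel_mul_le (K φ : 𝓢(E, ℂ)) (N : ℕ) :
    ∃ C : ℝ, ∀ x : E, Integrable (fun y => ‖K (x - y)‖ * ‖φ y‖) ∧
      ∫ y, ‖K (x - y)‖ * ‖φ y‖ ≤ C * ((1 + ‖x‖) ^ N)⁻¹ := by
  obtain ⟨S, hS⟩ : ∃ S : ℝ, 2 ^ N *
    ((Finset.Iic (N, 0)).sup fun m => SchwartzMap.seminorm ℝ m.1 m.2) K = S := ⟨_, rfl⟩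
  obtain ⟨S', hS'⟩ : ∃ S' : ℝ, 2 ^ (N + (Module.finrank ℝ E + 1)) *
    ((Finset.Iic (N + (Module.finrank ℝ E + 1), 0)).sup fun m => SchwartzMap.seminorm ℝ m.1 m.2) φ =
      S' := ⟨_, rfl⟩
  have hS0 : 0 ≤ S := hS ▸ schwartz_decay_const_nonneg K _
  have hS'0 : 0 ≤ S' := hS' ▸ schwartz_decay_const_nonneg φ _
  -- the `y`-weight `(1 + |y|)ᴺ |φ y|` is integrable
  have hφw : Integrable fun y : E => (1 + ‖y‖) ^ N * ‖φ y‖ := by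
    refine ((BMOInv.integrable_inv_one_add_norm_pow (E := E)).const_mul S').mono' (by fun_prop)
      (ae_of_all _ fun y => ?_)
    rw [Real.norm_of_nonneg (by positivity)]
    have h := norm_le_seminorm_mul_inv_one_add_pow φ (N + (Module.finrank ℝ E + 1)) y
    rw [hS', pow_add, mul_inv] at h
    have hpos : 0 < (1 + ‖y‖) ^ N := by positivity
    calc (1 + ‖y‖) ^ N * ‖φ y‖
        ≤ (1 + ‖y‖) ^ N *
            (S' * (((1 + ‖y‖) ^ N)⁻¹ * ((1 + ‖y‖) ^ (Module.finrank ℝ E + 1))⁻¹)) := by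
          gcongr
      _ = S' * ((1 + ‖y‖) ^ (Module.finrank ℝ E + 1))⁻¹ := by field_simp
  refine ⟨S * ∫ y, (1 + ‖y‖) ^ N * ‖φ y‖, fun x => ?_⟩
  have hpt : ∀ y, ‖K (x - y)‖ * ‖φ y‖ ≤
      S * ((1 + ‖x‖) ^ N)⁻¹ * ((1 + ‖y‖) ^ N * ‖φ y‖) := fun y => by
    have hK := norm_le_seminorm_mul_inv_one_add_pow K N (x - y)
    rw [hS] at hK
    calc ‖K (x - y)‖ * ‖φ y‖ ≤ S * ((1 + ‖x - y‖) ^ N)⁻¹ * ‖φ y‖ := by gcongr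
      _ ≤ S * ((1 + ‖y‖) ^ N * ((1 + ‖x‖) ^ N)⁻¹) * ‖φ y‖ := by
          gcongr; exact inv_one_add_norm_sub_pow_le x y N
      _ = S * ((1 + ‖x‖) ^ N)⁻¹ * ((1 + ‖y‖) ^ N * ‖φ y‖) := by ring
  have hint : Integrable (fun y => ‖K (x - y)‖ * ‖φ y‖) :=
    ((hφw.const_mul (S * ((1 + ‖x‖) ^ N)⁻¹))).mono' (by fun_prop) (ae_of_all _ fun y => by
      rw [Real.norm_of_nonneg (by positivity)]; exact hpt y)
  refine ⟨hint, ?_⟩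
  calc ∫ y, ‖K (x - y)‖ * ‖φ y‖ ≤ ∫ y, S * ((1 + ‖x‖) ^ N)⁻¹ * ((1 + ‖y‖) ^ N * ‖φ y‖) :=
        integral_mono hint (hφw.const_mul _) hpt
    _ = S * (∫ y, (1 + ‖y‖) ^ N * ‖φ y‖) * ((1 + ‖x‖) ^ N)⁻¹ := by
        rw [integral_const_mul]; ring

/-- **Fubini for a tempered function against a Schwartz kernel and a Schwartz test function**:
`∫ f(x) (∫ K(x - y) φ(y) dy) dx = ∫ φ(y) (∫ K(x - y) f(x) dx) dy` when `|f| (1 + |x|)^{-N} ∈ L¹`.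
[folklore] -/
theorem integral_ofReal_mul_integral_kernel_swap {f : E → ℝ} {N : ℕ}
    (hf : AEStronglyMeasurable f volume) (hfw : Integrable fun x => ‖f x‖ * ((1 + ‖x‖) ^ N)⁻¹)
    (K φ : 𝓢(E, ℂ)) :
    ∫ x, (f x : ℂ) * ∫ y, K (x - y) * φ y = ∫ y, φ y * ∫ x, K (x - y) * f x := by
  obtain ⟨C, hC⟩ := integral_norm_kernel_mul_le K φ N
  set F : E × E → ℂ := fun p => (f p.1 : ℂ) * (K (p.1 - p.2) * φ p.2) with hF
  have hf_meas : AEStronglyMeasurable (fun x => (f x : ℂ)) volume :=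
    Complex.continuous_ofReal.comp_aestronglyMeasurable hf
  have hF_meas : AEStronglyMeasurable F (volume.prod volume) := by
    refine hf_meas.comp_fst.mul (Continuous.aestronglyMeasurable ?_)
    exact (K.continuous.comp (continuous_fst.sub continuous_snd)).mul
      (φ.continuous.comp continuous_snd)
  have hF_int : Integrable F (volume.prod volume) := by
    rw [integrable_prod_iff hF_meas]
    constructor
    · refine ae_of_all _ fun x => ?_
      change Integrable (fun y => (f x : ℂ) * (K (x - y) * φ y)) volume
      refine Integrable.const_mul ((φ.integrable (μ := volume)).bdd_mul
        (c := SchwartzMap.seminorm ℝ 0 0 K) ?_ (ae_of_all _ fun y => norm_le_seminorm ℝ K _)) _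
      exact (K.continuous.comp (continuous_const.sub continuous_id)).aestronglyMeasurable
    · refine ((hfw.const_mul C)).mono' hF_meas.norm.integral_prod_right' (ae_of_all _ fun x => ?_)
      rw [Real.norm_of_nonneg (integral_nonneg fun y => norm_nonneg _)]
      simp only [hF, norm_mul, Complex.norm_real]
      rw [integral_const_mul]
      calc ‖f x‖ * ∫ y, ‖K (x - y)‖ * ‖φ y‖ ≤ ‖f x‖ * (C * ((1 + ‖x‖) ^ N)⁻¹) := by
            gcongr; exact (hC x).2
        _ = C * (‖f x‖ * ((1 + ‖x‖) ^ N)⁻¹) := by ring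
  calc ∫ x, (f x : ℂ) * ∫ y, K (x - y) * φ y = ∫ x, ∫ y, F (x, y) := by
        congr 1 with x
        simp only [hF, ← integral_const_mul]
    _ = ∫ y, ∫ x, F (x, y) := integral_integral_swap (by simpa [Function.uncurry_def] using hF_int)
    _ = ∫ y, φ y * ∫ x, K (x - y) * f x := by
        congr 1 with y
        simp only [hF, ← integral_const_mul]
        congr 1 with x
        ring

/-- Measurability of `y ↦ ∫ K(x - y) f(x) dx`. [folklore] -/
theorem aestronglyMeasurable_integral_kernel_mul {f : E → ℝ} (hf : AEStronglyMeasurable f volume)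
    (K : 𝓢(E, ℂ)) : AEStronglyMeasurable (fun y => ∫ x, K (x - y) * (f x : ℂ)) volume := by
  have hG : AEStronglyMeasurable (fun p : E × E => K (p.2 - p.1) * (f p.2 : ℂ))
      (volume.prod volume) :=
    ((K.continuous.comp (continuous_snd.sub continuous_fst)).aestronglyMeasurable).mul
      (Complex.continuous_ofReal.comp_aestronglyMeasurable hf).comp_snd
  exact hG.integral_prod_right'

end Fubini

/-! ## The weak divergence identity for Schwartz test functions -/

section SchwartzDivergence

open BMOInv in
/-- **The weak divergence identity for decaying test functions** (cutoff argument): if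
`u = div Φ` weakly, `‖Φ‖ (1 + |x|)^{-N} ∈ L¹`, and `g` is a smooth real function with
`|g|, ‖Dg‖ ≤ C (1 + |x|)^{-N}` and `u g ∈ L¹`, then `∫ u g = -∫ Dg(Φ)`. Proof: test the weak
identity with `χₙ g`, `χₙ(x) = β(x/(n+1))` for a bump `β`, and let `n → ∞` by dominated
convergence (`χₙ → 1`, `Dχₙ → 0` pointwise, `‖Dχₙ‖ ≤ M`). [folklore] -/
theorem HasWeakDivergenceRepresentation.integral_mul_eq_of_decay {u : E → ℝ} {Φ : E → E}
    (hdiv : HasWeakDivergenceRepresentation u Φ) {N : ℕ}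
    (hΦ : Integrable fun x => ‖Φ x‖ * ((1 + ‖x‖) ^ N)⁻¹) {g : E → ℝ} (hg : ContDiff ℝ ∞ g)
    {C : ℝ} (hg0 : ∀ x, ‖g x‖ ≤ C * ((1 + ‖x‖) ^ N)⁻¹)
    (hg1 : ∀ x, ‖fderiv ℝ g x‖ ≤ C * ((1 + ‖x‖) ^ N)⁻¹)
    (hu : Integrable fun x => u x * g x) :
    ∫ x, u x * g x = -∫ x, fderiv ℝ g x (Φ x) := by
  have hΦm : AEStronglyMeasurable Φ volume := hdiv.locallyIntegrable_field.aestronglyMeasurable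
  have hum : AEStronglyMeasurable u volume := hdiv.locallyIntegrable.aestronglyMeasurable
  have hgc : Continuous g := hg.continuous
  have hdgc : Continuous (fderiv ℝ g) := hg.continuous_fderiv (by simp)
  -- integrability of `‖Φ‖ |g|` and `‖Φ‖ ‖Dg‖`
  have hI2 : Integrable fun x => ‖Φ x‖ * ‖g x‖ := by
    refine (hΦ.const_mul C).mono' (hΦm.norm.mul hgc.aestronglyMeasurable.norm)
      (Eventually.of_forall fun x => ?_)
    rw [norm_mul, norm_norm, norm_norm]
    calc ‖Φ x‖ * ‖g x‖ ≤ ‖Φ x‖ * (C * ((1 + ‖x‖) ^ N)⁻¹) := by gcongr; exact hg0 x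
      _ = C * (‖Φ x‖ * ((1 + ‖x‖) ^ N)⁻¹) := by ring
  have hI3 : Integrable fun x => ‖Φ x‖ * ‖fderiv ℝ g x‖ := by
    refine (hΦ.const_mul C).mono' (hΦm.norm.mul hdgc.aestronglyMeasurable.norm)
      (Eventually.of_forall fun x => ?_)
    rw [norm_mul, norm_norm, norm_norm]
    calc ‖Φ x‖ * ‖fderiv ℝ g x‖ ≤ ‖Φ x‖ * (C * ((1 + ‖x‖) ^ N)⁻¹) := by gcongr; exact hg1 x
      _ = C * (‖Φ x‖ * ((1 + ‖x‖) ^ N)⁻¹) := by ring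
  -- cut-offs
  obtain ⟨β⟩ : Nonempty (ContDiffBump (0 : E)) := ⟨⟨1, 2, zero_lt_one, one_lt_two⟩⟩
  obtain ⟨M, hM⟩ := exists_bound_fderiv_cutoff β
  have hM0 : 0 ≤ M := (norm_nonneg _).trans (hM 0 0)
  have hmeas_fd : ∀ n : ℕ, AEStronglyMeasurable
      (fun z => g z * fderiv ℝ (fun z : E => β (((n : ℝ) + 1)⁻¹ • z)) z (Φ z)) volume := by
    intro n
    refine hgc.aestronglyMeasurable.mul ?_
    have hc : Continuous (fderiv ℝ (fun z : E => β (((n : ℝ) + 1)⁻¹ • z))) :=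
      (contDiff_cutoff β n).continuous_fderiv (by simp)
    exact isBoundedBilinearMap_apply.continuous.comp_aestronglyMeasurable
      (hc.aestronglyMeasurable.prodMk hΦm)
  have hmeas_dg : AEStronglyMeasurable (fun z => fderiv ℝ g z (Φ z)) volume :=
    isBoundedBilinearMap_apply.continuous.comp_aestronglyMeasurable
      (hdgc.aestronglyMeasurable.prodMk hΦm)
  have hJ1 : ∀ n : ℕ, Integrable fun z => β (((n : ℝ) + 1)⁻¹ • z) * fderiv ℝ g z (Φ z) := by
    intro n
    refine hI3.mono' ((continuous_cutoff β n).aestronglyMeasurable.mul hmeas_dg)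
      (Eventually.of_forall fun z => ?_)
    rw [norm_mul, Real.norm_eq_abs]
    calc |β (((n : ℝ) + 1)⁻¹ • z)| * ‖fderiv ℝ g z (Φ z)‖
        ≤ 1 * (‖fderiv ℝ g z‖ * ‖Φ z‖) :=
          mul_le_mul (abs_cutoff_le_one β n z) (ContinuousLinearMap.le_opNorm _ _)
            (norm_nonneg _) zero_le_one
      _ = ‖Φ z‖ * ‖fderiv ℝ g z‖ := by ring
  have hJ2 : ∀ n : ℕ, Integrable fun z =>
      g z * fderiv ℝ (fun z : E => β (((n : ℝ) + 1)⁻¹ • z)) z (Φ z) := by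
    intro n
    refine (hI2.const_mul M).mono' (hmeas_fd n) (Eventually.of_forall fun z => ?_)
    rw [norm_mul]
    calc ‖g z‖ * ‖fderiv ℝ (fun z : E => β (((n : ℝ) + 1)⁻¹ • z)) z (Φ z)‖
        ≤ ‖g z‖ * (M * ‖Φ z‖) := by
          gcongr
          exact (ContinuousLinearMap.le_opNorm _ _).trans
            (mul_le_mul_of_nonneg_right (hM n z) (norm_nonneg _))
      _ = M * (‖Φ z‖ * ‖g z‖) := by ring
  -- the weak identity tested with `χₙ g`
  have hweak : ∀ n : ℕ, ∫ z, u z * (β (((n : ℝ) + 1)⁻¹ • z) * g z) =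
      -(∫ z, β (((n : ℝ) + 1)⁻¹ • z) * fderiv ℝ g z (Φ z)) -
        ∫ z, g z * fderiv ℝ (fun z : E => β (((n : ℝ) + 1)⁻¹ • z)) z (Φ z) := by
    intro n
    have htest : IsTestFunctionOn ⊤ (fun z : E => β (((n : ℝ) + 1)⁻¹ • z) * g z) :=
      { contDiff := (contDiff_cutoff β n).mul hg
        hasCompactSupport := (hasCompactSupport_cutoff β n).mul_right
        tsupport_subset := by simp }
    rw [hdiv.integral_mul_eq _ htest]
    have hpt : (fun z => ⟪Φ z, gradient (fun z => β (((n : ℝ) + 1)⁻¹ • z) * g z) z⟫) =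
        fun z => β (((n : ℝ) + 1)⁻¹ • z) * fderiv ℝ g z (Φ z) +
          g z * fderiv ℝ (fun z : E => β (((n : ℝ) + 1)⁻¹ • z)) z (Φ z) := by
      funext z
      have hc : DifferentiableAt ℝ (fun z : E => β (((n : ℝ) + 1)⁻¹ • z)) z :=
        ((contDiff_cutoff β n).differentiable (by simp)) z
      have hgd : DifferentiableAt ℝ g z := (hg.differentiable (by simp)) z
      rw [inner_gradient_eq_fderiv, fderiv_fun_mul hc hgd]
      simp only [add_apply, FunLike.coe_smul, Pi.smul_apply, smul_eq_mul]
    rw [hpt, integral_add (hJ1 n) (hJ2 n)]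
    ring
  -- limits
  have hA : Tendsto (fun n : ℕ => ∫ z, u z * (β (((n : ℝ) + 1)⁻¹ • z) * g z)) atTop
      (𝓝 (∫ z, u z * g z)) := by
    refine tendsto_integral_of_dominated_convergence (fun z => ‖u z * g z‖)
      (fun n => hum.mul ((continuous_cutoff β n).mul hgc).aestronglyMeasurable) hu.norm
      (fun n => Eventually.of_forall fun z => ?_) (Eventually.of_forall fun z => ?_)
    · rw [norm_mul, norm_mul, norm_mul, Real.norm_eq_abs (β (((n : ℝ) + 1)⁻¹ • z))]
      calc ‖u z‖ * (|β (((n : ℝ) + 1)⁻¹ • z)| * ‖g z‖) ≤ ‖u z‖ * (1 * ‖g z‖) := by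
            gcongr
            exact abs_cutoff_le_one β n z
        _ = ‖u z‖ * ‖g z‖ := by rw [one_mul]
    · have h := ((tendsto_cutoff β z).mul_const (g z)).const_mul (u z)
      simpa using h
  have hB : Tendsto (fun n : ℕ => ∫ z, β (((n : ℝ) + 1)⁻¹ • z) * fderiv ℝ g z (Φ z)) atTop
      (𝓝 (∫ z, fderiv ℝ g z (Φ z))) := by
    refine tendsto_integral_of_dominated_convergence (fun z => ‖Φ z‖ * ‖fderiv ℝ g z‖)
      (fun n => (continuous_cutoff β n).aestronglyMeasurable.mul hmeas_dg) hI3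
      (fun n => Eventually.of_forall fun z => ?_) (Eventually.of_forall fun z => ?_)
    · rw [norm_mul, Real.norm_eq_abs]
      calc |β (((n : ℝ) + 1)⁻¹ • z)| * ‖fderiv ℝ g z (Φ z)‖
          ≤ 1 * (‖fderiv ℝ g z‖ * ‖Φ z‖) :=
            mul_le_mul (abs_cutoff_le_one β n z) (ContinuousLinearMap.le_opNorm _ _)
              (norm_nonneg _) zero_le_one
        _ = ‖Φ z‖ * ‖fderiv ℝ g z‖ := by ring
    · have h := (tendsto_cutoff β z).mul_const (fderiv ℝ g z (Φ z))
      simpa using h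
  have hC : Tendsto (fun n : ℕ => ∫ z, g z *
      fderiv ℝ (fun z : E => β (((n : ℝ) + 1)⁻¹ • z)) z (Φ z)) atTop (𝓝 0) := by
    have h := tendsto_integral_of_dominated_convergence (F := fun (n : ℕ) z =>
        g z * fderiv ℝ (fun z : E => β (((n : ℝ) + 1)⁻¹ • z)) z (Φ z)) (f := fun _ => 0)
      (μ := volume) (fun z => M * (‖Φ z‖ * ‖g z‖)) hmeas_fd (hI2.const_mul M)
      (fun n => Eventually.of_forall fun z => ?_) (Eventually.of_forall fun z => ?_)
    · simpa using h
    · rw [norm_mul]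
      calc ‖g z‖ * ‖fderiv ℝ (fun z : E => β (((n : ℝ) + 1)⁻¹ • z)) z (Φ z)‖
          ≤ ‖g z‖ * (M * ‖Φ z‖) := by
            gcongr
            exact (ContinuousLinearMap.le_opNorm _ _).trans
              (mul_le_mul_of_nonneg_right (hM n z) (norm_nonneg _))
        _ = M * (‖Φ z‖ * ‖g z‖) := by ring
    · refine tendsto_const_nhds.congr' ?_
      filter_upwards [eventually_fderiv_cutoff_eq_zero β z] with n hn
      simp [hn]
  have hlim : Tendsto (fun n : ℕ => ∫ z, u z * (β (((n : ℝ) + 1)⁻¹ • z) * g z)) atTop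
      (𝓝 (-(∫ z, fderiv ℝ g z (Φ z)) - 0)) := by
    rw [funext hweak]
    exact hB.neg.sub hC
  have := tendsto_nhds_unique hA hlim
  rw [this, sub_zero]

omit [FiniteDimensional ℝ E] [MeasurableSpace E] [BorelSpace E] in
/-- Decay of a Schwartz function and of its derivative with one constant:
`‖ψ x‖, ‖Dψ x‖ ≤ 2ᴺ p_{N,1}(ψ) (1 + |x|)^{-N}`. [folklore] -/
theorem schwartz_norm_le_and_norm_fderiv_le (ψ : 𝓢(E, ℂ)) (N : ℕ) :
    ∃ C : ℝ, (∀ x, ‖ψ x‖ ≤ C * ((1 + ‖x‖) ^ N)⁻¹) ∧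
      ∀ x, ‖fderiv ℝ ψ x‖ ≤ C * ((1 + ‖x‖) ^ N)⁻¹ := by
  refine ⟨2 ^ N * ((Finset.Iic (N, 1)).sup fun m => SchwartzMap.seminorm ℝ m.1 m.2) ψ,
    fun x => ?_, fun x => ?_⟩
  · have h := one_add_le_sup_seminorm_apply (𝕜 := ℝ) (m := (N, 1)) (k := N) (n := 0)
      le_rfl zero_le_one ψ x
    rw [norm_iteratedFDeriv_zero] at h
    rw [le_mul_inv_iff₀ (by positivity), mul_comm]
    exact h
  · have h := one_add_le_sup_seminorm_apply (𝕜 := ℝ) (m := (N, 1)) (k := N) (n := 1)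
      le_rfl le_rfl ψ x
    rw [norm_iteratedFDeriv_one] at h
    rw [le_mul_inv_iff₀ (by positivity), mul_comm]
    exact h

omit [FiniteDimensional ℝ E] [MeasurableSpace E] [BorelSpace E] in
/-- The derivative of the real part of a complex function. [folklore] -/
theorem fderiv_re_comp_apply {ψ : E → ℂ} {x : E} (hψ : DifferentiableAt ℝ ψ x) (v : E) :
    fderiv ℝ (fun y => (ψ y).re) x v = (fderiv ℝ ψ x v).re := by
  have h := (Complex.reCLM.hasFDerivAt.comp x hψ.hasFDerivAt).fderiv
  rw [show (fun y => (ψ y).re) = Complex.reCLM ∘ ψ from rfl, h]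
  rfl

omit [FiniteDimensional ℝ E] [MeasurableSpace E] [BorelSpace E] in
/-- The derivative of the imaginary part of a complex function. [folklore] -/
theorem fderiv_im_comp_apply {ψ : E → ℂ} {x : E} (hψ : DifferentiableAt ℝ ψ x) (v : E) :
    fderiv ℝ (fun y => (ψ y).im) x v = (fderiv ℝ ψ x v).im := by
  have h := (Complex.imCLM.hasFDerivAt.comp x hψ.hasFDerivAt).fderiv
  rw [show (fun y => (ψ y).im) = Complex.imCLM ∘ ψ from rfl, h]
  rfl

omit [FiniteDimensional ℝ E] [MeasurableSpace E] [BorelSpace E] in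
/-- `‖D(re ψ)‖ ≤ ‖Dψ‖`. [folklore] -/
theorem norm_fderiv_re_comp_le {ψ : E → ℂ} {x : E} (hψ : DifferentiableAt ℝ ψ x) :
    ‖fderiv ℝ (fun y => (ψ y).re) x‖ ≤ ‖fderiv ℝ ψ x‖ := by
  refine ContinuousLinearMap.opNorm_le_bound _ (norm_nonneg _) fun v => ?_
  rw [fderiv_re_comp_apply hψ, Real.norm_eq_abs]
  exact (abs_re_le_norm _).trans (ContinuousLinearMap.le_opNorm _ _)

omit [FiniteDimensional ℝ E] [MeasurableSpace E] [BorelSpace E] in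
/-- `‖D(im ψ)‖ ≤ ‖Dψ‖`. [folklore] -/
theorem norm_fderiv_im_comp_le {ψ : E → ℂ} {x : E} (hψ : DifferentiableAt ℝ ψ x) :
    ‖fderiv ℝ (fun y => (ψ y).im) x‖ ≤ ‖fderiv ℝ ψ x‖ := by
  refine ContinuousLinearMap.opNorm_le_bound _ (norm_nonneg _) fun v => ?_
  rw [fderiv_im_comp_apply hψ, Real.norm_eq_abs]
  exact (abs_im_le_norm _).trans (ContinuousLinearMap.le_opNorm _ _)

/-- **The weak divergence identity for Schwartz test functions** (folklore; the cutoff/density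
argument `C_c^∞ ⊂ 𝓢`): if `u = div Φ` weakly (`HasWeakDivergenceRepresentation u Φ`, an identity
against compactly supported smooth functions), `Φ` is integrable against the polynomial weight
`(1 + |x|)^{-N}` and `ψ u ∈ L¹` for the Schwartz function `ψ`, then `∫ ψ u = -∫ dψₓ(Φ(x)) dx`
(for real `ψ` the right-hand side is `-∫ ⟪Φ, ∇ψ⟫`). Proof: `integral_mul_eq_of_decay` applied to
`re ψ` and `im ψ`. [folklore] -/
theorem HasWeakDivergenceRepresentation.integral_schwartz_mul_eq {u : E → ℝ} {Φ : E → E}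
    (hdiv : HasWeakDivergenceRepresentation u Φ) (N : ℕ)
    (hΦ : Integrable fun x => ‖Φ x‖ * ((1 + ‖x‖) ^ N)⁻¹) (ψ : 𝓢(E, ℂ))
    (hψu : Integrable fun x => ψ x * u x) :
    ∫ x, ψ x * u x = -∫ x, fderiv ℝ ψ x (Φ x) := by
  have hΦm : AEStronglyMeasurable Φ volume := hdiv.locallyIntegrable_field.aestronglyMeasurable
  obtain ⟨C, h0, h1⟩ := schwartz_norm_le_and_norm_fderiv_le ψ N
  have hdiff : ∀ x, DifferentiableAt ℝ ψ x := fun x => ψ.differentiableAt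
  -- the real and imaginary parts of `ψ`
  have hre_smooth : ContDiff ℝ ∞ fun x => (ψ x).re := Complex.reCLM.contDiff.comp (ψ.smooth ⊤)
  have him_smooth : ContDiff ℝ ∞ fun x => (ψ x).im := Complex.imCLM.contDiff.comp (ψ.smooth ⊤)
  have hre0 : ∀ x, ‖(ψ x).re‖ ≤ C * ((1 + ‖x‖) ^ N)⁻¹ := fun x =>
    (abs_re_le_norm _).trans (h0 x)
  have him0 : ∀ x, ‖(ψ x).im‖ ≤ C * ((1 + ‖x‖) ^ N)⁻¹ := fun x =>
    (abs_im_le_norm _).trans (h0 x)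
  have hre1 : ∀ x, ‖fderiv ℝ (fun y => (ψ y).re) x‖ ≤ C * ((1 + ‖x‖) ^ N)⁻¹ := fun x =>
    (norm_fderiv_re_comp_le (hdiff x)).trans (h1 x)
  have him1 : ∀ x, ‖fderiv ℝ (fun y => (ψ y).im) x‖ ≤ C * ((1 + ‖x‖) ^ N)⁻¹ := fun x =>
    (norm_fderiv_im_comp_le (hdiff x)).trans (h1 x)
  have hure : Integrable fun x => u x * (ψ x).re := by
    refine hψu.re.congr (Eventually.of_forall fun x => ?_)
    simp [mul_comm]
  have huim : Integrable fun x => u x * (ψ x).im := by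
    refine hψu.im.congr (Eventually.of_forall fun x => ?_)
    simp [mul_comm]
  have Hre := hdiv.integral_mul_eq_of_decay hΦ hre_smooth hre0 hre1 hure
  have Him := hdiv.integral_mul_eq_of_decay hΦ him_smooth him0 him1 huim
  -- integrability of `Dψ(Φ)`
  have hdgc : Continuous (fderiv ℝ (ψ : E → ℂ)) := (ψ.smooth 1).continuous_fderiv (by simp)
  have hI : Integrable fun x => fderiv ℝ ψ x (Φ x) := by
    refine (hΦ.const_mul C).mono'
      (isBoundedBilinearMap_apply.continuous.comp_aestronglyMeasurable
        (hdgc.aestronglyMeasurable.prodMk hΦm))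
      (Eventually.of_forall fun x => ?_)
    calc ‖fderiv ℝ ψ x (Φ x)‖ ≤ ‖fderiv ℝ ψ x‖ * ‖Φ x‖ := ContinuousLinearMap.le_opNorm _ _
      _ ≤ C * ((1 + ‖x‖) ^ N)⁻¹ * ‖Φ x‖ := by gcongr; exact h1 x
      _ = C * (‖Φ x‖ * ((1 + ‖x‖) ^ N)⁻¹) := by ring
  have e1 : (∫ x, ψ x * (u x : ℂ)).re = ∫ x, u x * (ψ x).re := by
    rw [← Complex.reCLM_apply (∫ x, ψ x * (u x : ℂ)), ← Complex.reCLM.integral_comp_comm hψu]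
    congr 1 with x
    simp [mul_comm]
  have e2 : (∫ x, fderiv ℝ ψ x (Φ x)).re = ∫ x, fderiv ℝ (fun y => (ψ y).re) x (Φ x) := by
    rw [← Complex.reCLM_apply (∫ x, fderiv ℝ ψ x (Φ x)), ← Complex.reCLM.integral_comp_comm hI]
    congr 1 with x
    rw [Complex.reCLM_apply, fderiv_re_comp_apply (hdiff x)]
  have e3 : (∫ x, ψ x * (u x : ℂ)).im = ∫ x, u x * (ψ x).im := by
    rw [← Complex.imCLM_apply (∫ x, ψ x * (u x : ℂ)), ← Complex.imCLM.integral_comp_comm hψu]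
    congr 1 with x
    simp [mul_comm]
  have e4 : (∫ x, fderiv ℝ ψ x (Φ x)).im = ∫ x, fderiv ℝ (fun y => (ψ y).im) x (Φ x) := by
    rw [← Complex.imCLM_apply (∫ x, fderiv ℝ ψ x (Φ x)), ← Complex.imCLM.integral_comp_comm hI]
    congr 1 with x
    rw [Complex.imCLM_apply, fderiv_im_comp_apply (hdiff x)]
  apply Complex.ext
  · rw [e1, neg_re, e2, Hre]
  · rw [e3, neg_im, e4, Him]

end SchwartzDivergence

/-! ## The main lemma -/

section MainLemma

/-- `2ʲ → 0` as `j → -∞` in `ℤ`. [folklore] -/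
theorem tendsto_two_zpow_atBot : Tendsto (fun j : ℤ => (2 : ℝ) ^ j) atBot (𝓝 0) := by
  have h := (tendsto_rpow_atBot_of_base_gt_one 2 one_lt_two).comp
    (tendsto_intCast_atBot_iff (R := ℝ).2 tendsto_id)
  refine h.congr fun j => ?_
  simp [Real.rpow_intCast]

/-- A vector field with `BMO` components is polynomially integrable:
`‖Φ‖ (1 + |x|)^{-d-1} ∈ L¹`. [folklore] -/
theorem integrable_norm_field_mul_inv_one_add_norm_pow {Φ : E → E}
    (hΦm : AEStronglyMeasurable Φ volume) (hΦ : ∀ v : E, MemBMO (fun x => ⟪Φ x, v⟫)) :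
    Integrable fun x => ‖Φ x‖ * ((1 + ‖x‖) ^ (Module.finrank ℝ E + 1))⁻¹ := by
  classical
  let b := stdOrthonormalBasis ℝ E
  have hcomp : ∀ i, Integrable fun x => ‖⟪Φ x, b i⟫‖ * ((1 + ‖x‖) ^ (Module.finrank ℝ E + 1))⁻¹ :=
    fun i => MemBMO.integrable_norm_mul_inv_one_add_norm_pow (hΦ (b i))
  refine (integrable_finsetSum Finset.univ fun i _ => hcomp i).mono' (by fun_prop)
    (ae_of_all _ fun x => ?_)
  rw [Real.norm_of_nonneg (by positivity), ← Finset.sum_mul]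
  gcongr
  calc ‖Φ x‖ = ‖∑ i, ⟪b i, Φ x⟫ • b i‖ := by rw [b.sum_repr' (Φ x)]
    _ ≤ ∑ i, ‖⟪b i, Φ x⟫ • b i‖ := norm_sum_le _ _
    _ = ∑ i, ‖⟪Φ x, b i⟫‖ := by
        congr 1 with i
        rw [norm_smul, b.orthonormal.1 i, mul_one, real_inner_comm]

/-- **Main lemma.** For `u = div Φ` with `Φ ∈ BMO` and a smooth compactly supported profile `ρ`,
the distributions `ρ(2^{-j}D) U` are bounded functions `Gⱼ` with `‖Gⱼ‖_∞ ≤ C 2ʲ`, given by the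
mean-zero kernels of the derivative symbols (see the module docstring).
[cite: GrafakosMFA2014, Thm. 3.3.8 (3.3.18)] -/
theorem MemBMOInv.exists_bounded_repr {u : E → ℝ} {Φ : E → E}
    (hΦ : ∀ v : E, MemBMO (fun x => ⟪Φ x, v⟫))
    (hdiv : HasWeakDivergenceRepresentation u Φ) (U : 𝓢'(E, ℂ))
    (hU : ∀ φ : 𝓢(E, ℂ), Integrable (fun x => φ x * u x) ∧ U φ = ∫ x, φ x * u x)
    {ρ : E → ℂ} (hρ : ContDiff ℝ ∞ ρ) (hρc : HasCompactSupport ρ) :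
    ∃ C : ℝ, ∀ j : ℤ, ∃ G : E → ℂ, AEStronglyMeasurable G volume ∧ (∀ y, ‖G y‖ ≤ 2 ^ j * C) ∧
      ∀ φ : 𝓢(E, ℂ), U (𝓕 (smulLeftCLM ℂ (dilateSymbol ρ j) (𝓕⁻ φ))) = ∫ y, φ y * G y := by
  classical
  let b := stdOrthonormalBasis ℝ E
  let f : Fin (Module.finrank ℝ E) → E → ℝ := fun i x => ⟪Φ x, b i⟫
  have hf : ∀ i, MemBMO (f i) := fun i => hΦ (b i)
  have hf_meas : ∀ i, AEStronglyMeasurable (f i) volume := fun i =>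
    (hf i).locallyIntegrable.aestronglyMeasurable
  have hfw : ∀ i, Integrable fun x => ‖f i x‖ * ((1 + ‖x‖) ^ (Module.finrank ℝ E + 1))⁻¹ :=
    fun i => MemBMO.integrable_norm_mul_inv_one_add_norm_pow (hf i)
  have hΦw : Integrable fun x => ‖Φ x‖ * ((1 + ‖x‖) ^ (Module.finrank ℝ E + 1))⁻¹ :=
    integrable_norm_field_mul_inv_one_add_norm_pow
      hdiv.locallyIntegrable_field.aestronglyMeasurable hΦ
  -- derivative symbols and their kernels
  let τ : Fin (Module.finrank ℝ E) → E → ℂ := fun i => derivSymbol ρ (b i)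
  have hτ : ∀ i, ContDiff ℝ ∞ (τ i) := fun i => derivSymbol_contDiff hρ _
  have hτc : ∀ i, HasCompactSupport (τ i) := fun i => derivSymbol_hasCompactSupport hρc _
  let T₀ : Fin (Module.finrank ℝ E) → 𝓢(E, ℂ) := fun i => (hτc i).toSchwartzMap (hτ i)
  let T : Fin (Module.finrank ℝ E) → ℤ → 𝓢(E, ℂ) := fun i j =>
    (dilateSymbol_hasCompactSupport (hτc i) j).toSchwartzMap (dilateSymbol_contDiff (hτ i) j)
  let K₀ : Fin (Module.finrank ℝ E) → 𝓢(E, ℂ) := fun i => 𝓕 (T₀ i)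
  let K : Fin (Module.finrank ℝ E) → ℤ → 𝓢(E, ℂ) := fun i j => 𝓕 (T i j)
  have hK₀ : ∀ i, (∫ x, K₀ i x) = 0 := fun i => by
    rw [integral_fourier_schwartz_eq_apply_zero]
    exact derivSymbol_zero ρ (b i)
  have hKK : ∀ i j (z : E), K i j z =
      (((2 : ℝ) ^ j) ^ Module.finrank ℝ E : ℝ) * K₀ i ((2 : ℝ) ^ j • z) := by
    intro i j z
    have h2 : (2 : ℝ) ^ j ≠ 0 := zpow_ne_zero j two_ne_zero
    have hcoe : (⇑(T i j) : E → ℂ) = fun ξ => τ i (((2 : ℝ) ^ j)⁻¹ • ξ) := by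
      ext ξ
      change dilateSymbol (τ i) j ξ = _
      rw [dilateSymbol_apply, zpow_neg]
    change (𝓕 (T i j)) z = _ * (𝓕 (T₀ i)) ((2 : ℝ) ^ j • z)
    rw [fourier_coe, fourier_coe, hcoe, fourier_comp_inv_smul _ h2,
      abs_of_pos (zpow_pos two_pos j)]
    rfl
  -- the constant
  obtain ⟨C₁, hC₁⟩ := MemBMO.norm_integral_kernel_mul_le (E := E)
  let S : Fin (Module.finrank ℝ E) → ℝ := fun i => 2 ^ (Module.finrank ℝ E + 1) *
    ((Finset.Iic (Module.finrank ℝ E + 1, 0)).sup fun m => SchwartzMap.seminorm ℝ m.1 m.2) (K₀ i)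
  refine ⟨∑ i, C₁ * S i * (eBMOSeminorm (f i) volume).toReal, fun j => ?_⟩
  have h2j : (0 : ℝ) < (2 : ℝ) ^ j := zpow_pos two_pos j
  -- the functions gᵢ and G
  let g : Fin (Module.finrank ℝ E) → E → ℂ := fun i y => ∫ x, K i j (x - y) * (f i x : ℂ)
  have hg_meas : ∀ i, AEStronglyMeasurable (g i) volume := fun i =>
    aestronglyMeasurable_integral_kernel_mul (hf_meas i) (K i j)
  have hg_bound : ∀ i y, ‖g i y‖ ≤ C₁ * S i * (eBMOSeminorm (f i) volume).toReal := by
    intro i y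
    have h := hC₁ (K₀ i) (hK₀ i) (f i) (hf i) ((2 : ℝ) ^ j) h2j y
    have hgi : g i y = ∫ x, ((((2 : ℝ) ^ j) ^ Module.finrank ℝ E : ℝ) : ℂ) *
        K₀ i ((2 : ℝ) ^ j • (x - y)) * f i x := by
      change (∫ x, K i j (x - y) * (f i x : ℂ)) = _
      congr 1 with x
      rw [hKK]
    rw [hgi]
    exact h
  refine ⟨fun y => -(2 : ℂ) ^ j * ∑ i, g i y, ?_, ?_, ?_⟩
  · exact aestronglyMeasurable_const.mul
      (Finset.aestronglyMeasurable_fun_sum _ fun i _ => hg_meas i)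
  · intro y
    rw [norm_mul, norm_neg, norm_zpow, Complex.norm_two]
    refine mul_le_mul_of_nonneg_left ?_ h2j.le
    exact (norm_sum_le Finset.univ fun i => g i y).trans
      (Finset.sum_le_sum fun i _ => hg_bound i y)
  · intro φ
    set ψ : 𝓢(E, ℂ) := 𝓕 (smulLeftCLM ℂ (dilateSymbol ρ j) (𝓕⁻ φ)) with hψ
    rw [(hU ψ).2, hdiv.integral_schwartz_mul_eq (Module.finrank ℝ E + 1) hΦw ψ (hU ψ).1]
    -- expand `dψ(Φ)` in the basis
    have hderiv : ∀ x, fderiv ℝ ψ x (Φ x) = ∑ i, (f i x : ℂ) * (∂_{b i} ψ) x := by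
      intro x
      conv_lhs => rw [← b.sum_repr' (Φ x)]
      rw [map_sum]
      congr 1 with i
      rw [map_smul, lineDerivOp_apply_eq_fderiv, real_inner_comm, Complex.real_smul]
    -- the directional derivatives of `ψ`
    have hDi : ∀ i (x : E), (∂_{b i} ψ) x = (2 : ℂ) ^ j * ∫ y, K i j (x - y) * φ y := by
      intro i x
      rw [hψ, lineDerivOp_fourier_smulLeftCLM_dilateSymbol hρ hρc (b i) j φ, smul_apply,
        smul_eq_mul]
      congr 1
      exact fourier_smulLeftCLM_fourierInv_apply (T i j) φ x
    simp_rw [hderiv]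
    rw [integral_finsetSum _ fun i _ =>
      integrable_ofReal_mul_schwartz (hf_meas i) (hfw i) (∂_{b i} ψ)]
    have hFub : ∀ i, ∫ x, (f i x : ℂ) * (∂_{b i} ψ) x = (2 : ℂ) ^ j * ∫ y, φ y * g i y := by
      intro i
      simp_rw [hDi]
      have h := integral_ofReal_mul_integral_kernel_swap (hf_meas i) (hfw i) (K i j) φ
      rw [← h, ← integral_const_mul]
      congr 1 with x
      ring
    simp_rw [hFub]
    rw [← Finset.mul_sum, ← integral_finsetSum _ fun i _ => ?_]
    · rw [← neg_mul, ← integral_const_mul]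
      congr 1 with y
      rw [Finset.mul_sum, Finset.mul_sum, Finset.mul_sum]
      congr 1 with i
      ring
    · exact (φ.integrable (μ := volume)).mul_bdd (hg_meas i) (ae_of_all _ fun y => hg_bound i y)

end MainLemma

/-! ## `BMO⁻¹ ⊂ Ḃ^{-1}_{∞,∞}` -/

section Final

/-- The dyadic weight `2^{j·(-1)}` of `Ḃ^{-1}` in `ℝ≥0∞` is `ofReal (2ʲ)⁻¹`. [folklore] -/
theorem two_rpow_neg_intCast (j : ℤ) :
    (2 : ℝ≥0∞) ^ ((j : ℝ) * (-1)) = ENNReal.ofReal ((2 : ℝ) ^ j)⁻¹ := by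
  rw [show (2 : ℝ≥0∞) = ENNReal.ofReal 2 by norm_num, ENNReal.ofReal_rpow_of_pos two_pos,
    mul_neg_one, Real.rpow_neg zero_le_two, Real.rpow_intCast]

/-- **`BMO⁻¹ ⊂ Ḃ^{-1}_{∞,∞}` (discharge of `Literature.Analysis.FunctionSpaces.MemBMOInv.memHomBesov_neg_one_top`).**
Koch–Tataru, Adv. Math. 157 (2001), §1, Theorem 1 and (22): the caloric extension of
`u ∈ BMO⁻¹` obeys `|e^{tΔ}u(x)| ≤ c t^{-1/2} ‖u‖_{BMO⁻¹}`, i.e. `BMO⁻¹ ↪ Ḃ^{-1}_{∞,∞}`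
(Lemarié-Rieusset 2016, p. 229: `‖u‖_{Ḃ^{-1}_{∞,∞}} ≤ C ‖u‖_{BMO⁻¹}`). In the Littlewood–Paley
form of `LittlewoodPaley.lean`: every `u ∈ BMO⁻¹` represented by the tempered distribution `U`
satisfies `sup_j 2^{-j} ‖Δ̇ⱼ U‖_{L^∞} < ∞` and `Ṡⱼ U → 0` in `𝓢'` as `j → -∞`, both from the main
lemma `MemBMOInv.exists_bounded_repr` (`‖ρ(2^{-j}D) U‖_∞ ≤ C 2ʲ`).
[cite: KochTataruAdvMath2001, §1 Theorem 1 and (22)] -/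
theorem MemBMOInv.memHomBesov_neg_one_top_holds : MemBMOInv.memHomBesov_neg_one_top (E := E) := by
  intro u hu U hU
  obtain ⟨Φ, hΦ, hdiv⟩ := hu
  refine ⟨?_, ?_⟩
  · -- finiteness of the homogeneous Besov norm: `‖Δ̇ⱼ U‖_∞ ≤ C 2ʲ`
    obtain ⟨C, hC⟩ := MemBMOInv.exists_bounded_repr hΦ hdiv U hU
      (contDiff_dyadicSymbol 0) (hasCompactSupport_dyadicSymbol 0)
    rw [eHomBesovNorm_top]
    refine lt_of_le_of_lt (iSup_le fun j => ?_) (ENNReal.ofReal_lt_top (r := C))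
    obtain ⟨G, hGm, hGb, hGU⟩ := hC j
    have hGmem : MemLp G ⊤ volume := memLp_top_of_bound hGm (2 ^ j * C) (ae_of_all _ hGb)
    have hrep : ((hGmem.toLp G : Lp ℂ ⊤ volume) : 𝓢'(E, ℂ)) = lpBlock j U := by
      ext φ
      rw [Lp.toTemperedDistribution_apply, lpBlock_apply,
        TemperedDistribution.fourierMultiplierCLM_apply_apply, dyadicSymbol_eq_dilateSymbol, hGU φ]
      refine integral_congr_ae ?_
      filter_upwards [hGmem.coeFn_toLp] with y hy
      rw [hy, smul_eq_mul]
    have hnorm : ‖(hGmem.toLp G : Lp ℂ ⊤ volume)‖ₑ ≤ ENNReal.ofReal (2 ^ j * C) := by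
      rw [Lp.enorm_toLp, eLpNorm_exponent_top]
      exact eLpNormEssSup_le_of_ae_bound (ae_of_all _ hGb)
    have h2j : (0 : ℝ) < (2 : ℝ) ^ j := zpow_pos two_pos j
    calc (2 : ℝ≥0∞) ^ ((j : ℝ) * (-1)) * eLpNormDistrib ⊤ (lpBlock j U)
        ≤ (2 : ℝ≥0∞) ^ ((j : ℝ) * (-1)) * ‖(hGmem.toLp G : Lp ℂ ⊤ volume)‖ₑ := by
          rw [← hrep]
          gcongr
          exact eLpNormDistrib_coe_le _
      _ ≤ (2 : ℝ≥0∞) ^ ((j : ℝ) * (-1)) * ENNReal.ofReal (2 ^ j * C) := by gcongr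
      _ = ENNReal.ofReal C := by
          rw [two_rpow_neg_intCast, ← ENNReal.ofReal_mul (inv_nonneg.2 h2j.le),
            inv_mul_cancel_left₀ h2j.ne']
  · -- the realisation condition: `|⟨Ṡⱼ U, φ⟩| ≤ C 2ʲ ‖φ‖_{L¹} → 0`
    obtain ⟨C, hC⟩ := MemBMOInv.exists_bounded_repr hΦ hdiv U hU
      (contDiff_lowFreqSymbol 0) (hasCompactSupport_lowFreqSymbol 0)
    rw [PointwiseConvergenceCLM.tendsto_iff_forall_tendsto]
    intro φ
    rw [_root_.zero_apply, tendsto_zero_iff_norm_tendsto_zero]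
    have hbound : ∀ j : ℤ, ‖lowFreqCutoff j U φ‖ ≤ 2 ^ j * (|C| * ∫ y, ‖φ y‖) := by
      intro j
      obtain ⟨G, hGm, hGb, hGU⟩ := hC j
      rw [lowFreqCutoff_apply, TemperedDistribution.fourierMultiplierCLM_apply_apply,
        lowFreqSymbol_eq_dilateSymbol, hGU φ]
      have h2j : (0 : ℝ) ≤ (2 : ℝ) ^ j := (zpow_pos two_pos j).le
      calc ‖∫ y, φ y * G y‖ ≤ ∫ y, ‖φ y‖ * (2 ^ j * |C|) := by
            refine norm_integral_le_of_norm_le ((φ.integrable (μ := volume)).norm.mul_const _)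
              (ae_of_all _ fun y => ?_)
            rw [norm_mul]
            gcongr
            exact (hGb y).trans (by gcongr; exact le_abs_self C)
        _ = 2 ^ j * (|C| * ∫ y, ‖φ y‖) := by rw [integral_mul_const]; ring
    refine squeeze_zero (fun j => norm_nonneg _) hbound ?_
    rw [← zero_mul (|C| * ∫ y, ‖φ y‖)]
    exact tendsto_two_zpow_atBot.mul_const _

end Final

end Literature.Analysis.FunctionSpaces
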